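import Summits.NavierStokesRegularity.NavierStokesRegularity.Theses.LandauTail
import Literature.Analysis.FluidPDE.HomogeneousEuler

/-!
# NavierStokesRegularity — route `LandauTail`, crux `LandauTailBlowup` (stmt-NavierStokesRegularity-1944):
glue theorems of its two typed cuts

Strategist file (crux-strategist seat `planner-cstrat-stmt-NavierStokesRegularity-1944-h1-0`, 2026-08-17;
tree path `Cruxes/LandauTailBlowup/Split.lean` — Summits/Theorems is prover-only, so the glue is published as
a crux workfile and attached as evidence on stmt-NavierStokesRegularity-1944; theorems only, no definitions,
no named facts). It proves, sorry-free, the assemblies of the two registered skeleton lines of the crux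
`X = LandauTail.LandauTailBlowup` (a finite-energy Leray–Hopf classical solution from a rapidly decaying datum
with a parabolic-scale Landau tail):

* `landauTailBlowup_of_subs : LandauTailLocal → LandauTailTransfer → LandauTailBlowup` — the route's own
  layer-1 cut (line `Cruxes/LandauTailBlowup/Lines/birth.lean`; items stmt-…-1946, 1948): modus ponens across
  the definitional seam `LandauTailTransfer ≝ (body of LandauTailLocal) → (body of LandauTailBlowup)`.
* `landauTailLocal_of_frozenRigidity : FrozenProfileLocal → PuncturedLerayRigiditySmall → LandauTailLocal`
  and `landauTailBlowup_of_frozenRigidity : FrozenProfileLocal → PuncturedLerayRigiditySmall →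
  LandauTailTransfer → LandauTailBlowup` — the strategist's alternative cut (line
  `Cruxes/LandauTailBlowup/Lines/frozen-rigidity.lean`), written with the two new pieces INLINE (they are not
  route decls yet):
  - `FrozenProfileLocal` (∃): for every ε > 0 a local-energy-class first singularity at (0,0), ν = 1, whose
    parabolic rescaling freezes pointwise off 0 onto SOME nonzero profile `V` (smooth off 0, junk value
    `V 0 = 0`) solving Leray's backward profile system with rate 1/2 OFF THE ORIGIN, pressure `Q`, with
    spatial envelope `‖y‖‖V y‖ ≤ ε` — it does not say that `V` is homogeneous or steady;
  - `PuncturedLerayRigiditySmall` (∀): punctured Leray profiles with small envelope are homogeneous of degree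
    −1 off the origin ("Miura–Tsai 2012 Cor. 1.5 for Leray's profile equation"; steady sibling: Šverák's
    Conjecture 1.4 on solutions of steady NS in ℝ³∖{0} with |u| ≤ C/|x|, proved for small C by Miura–Tsai,
    JMFM 14 (2012) = arXiv:0810.2004, and Korolev–Šverák arXiv:0711.0560).
  The proof is not modus ponens: degree −1 homogeneity off 0 gives Euler's relation `DV(y)y = −V(y)` (tree
  lemma `Literature.Analysis.FluidPDE.fderiv_apply_self_of_smul_eq_rpow_smul`), which cancels the Leray term
  `(1/2)V + (1/2)(y·∇)V` of the punctured profile equation and leaves the steady Navier–Stokes system off the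
  origin with pressure `Q`; the normalisation `V 0 = 0` extends the homogeneity clause to all `x`; the
  classical / local-energy / convergence clauses are carried verbatim into `LandauTailLocal`.

References: H. Miura, T.-P. Tsai, J. Math. Fluid Mech. 14 (2012) 33–41 = arXiv:0810.2004, Thm 1.1, Cor 1.3,
Conj 1.4, Cor 1.5 [MiuraTsai2012]; V. Šverák, arXiv:math/0604550 [Sverak2011]; A. Korolev, V. Šverák,
arXiv:0711.0560 [KorolevSverak2011]; T.-P. Tsai, ARMA 143 (1998) Thm 1–2 [Tsai1998]; J. Nečas, M. Růžička,
V. Šverák, Acta Math. 176 (1996) [NecasRuzickaSverak1996]; B. Pineau, V. Vicol, arXiv:2607.09619 §5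
[PineauVicol2026].
-/

noncomputable section

open Set Filter Topology MeasureTheory

-- the summit-side namespace repeats a component by design (D-0017)
set_option linter.dupNamespace false

namespace Summit.NavierStokesRegularity.NavierStokesRegularity.Cruxes.LandauTailBlowup.Split

open Literature.Analysis.FluidPDE
open Summit.NavierStokesRegularity.NavierStokesRegularity.Theses.LandauTail

/-- **Birth cut of `LandauTailBlowup`**: `LandauTailLocal → LandauTailTransfer → LandauTailBlowup` (modus
ponens across the definitional seam; items stmt-NavierStokesRegularity-1946, 1948 ⊢ 1944). [folklore] -/
theorem landauTailBlowup_of_subs (h₁ : LandauTailLocal) (h₂ : LandauTailTransfer) : LandauTailBlowup :=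
  h₂ h₁

/-- Euler's relation for a field homogeneous of degree −1 along the ray through `y`:
`DV(y) y = −V(y)` (tree lemma `fderiv_apply_self_of_smul_eq_rpow_smul` with `m = −1`). [folklore] -/
theorem fderiv_apply_self_of_forall_inv_smul {V : EuclideanSpace ℝ (Fin 3) → EuclideanSpace ℝ (Fin 3)}
    {y : EuclideanSpace ℝ (Fin 3)} (hhom : ∀ c : ℝ, 0 < c → V (c • y) = c⁻¹ • V y)
    (hd : DifferentiableAt ℝ V y) : fderiv ℝ V y y = (-1 : ℝ) • V y := by
  refine fderiv_apply_self_of_smul_eq_rpow_smul (m := -1) (fun c hc => ?_) hd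
  rw [Real.rpow_neg_one]
  exact hhom c hc

/-- **Frozen-profile cut, inner glue**: `FrozenProfileLocal → PuncturedLerayRigiditySmall → LandauTailLocal`
(the two pieces inline; conclusion = route item stmt-NavierStokesRegularity-1946 by name). Rigidity makes the
frozen punctured Leray profile homogeneous of degree −1; Euler's relation then removes the Leray term from the
profile equation, leaving steady Navier–Stokes off the origin. [cite: MiuraTsai2012, Cor 1.5 (steady sibling)] -/
theorem landauTailLocal_of_frozenRigidity
    (h₁ : ∀ ε : ℝ, 0 < ε → ∃ (u : ℝ → EuclideanSpace ℝ (Fin 3) → EuclideanSpace ℝ (Fin 3)) (p : ℝ → EuclideanSpace ℝ (Fin 3) → ℝ) (V : EuclideanSpace ℝ (Fin 3) → EuclideanSpace ℝ (Fin 3)) (Q : EuclideanSpace ℝ (Fin 3) → ℝ), (ContDiffOn ℝ (⊤ : ℕ∞) V {0}ᶜ ∧ ContDiffOn ℝ (⊤ : ℕ∞) Q {0}ᶜ ∧ V 0 = 0 ∧ (∀ y : EuclideanSpace ℝ (Fin 3), y ≠ 0 → -((1 : ℝ) • Laplacian.laplacian V y) + (1 / 2 : ℝ) • V y + (1 / 2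 : ℝ) • fderiv ℝ V y y + Literature.Analysis.FluidPDE.convect V V y + gradient Q y = 0) ∧ (∀ y : EuclideanSpace ℝ (Fin 3), y ≠ 0 → Literature.Analysis.FluidPDE.VectorCalculus.divergence V y = 0) ∧ (∃ y : EuclideanSpace ℝ (Fin 3), V y ≠ 0) ∧ (∀ y : EuclideanSpace ℝ (Fin 3), y ≠ 0 → ‖y‖ * ‖V y‖ ≤ ε)) ∧ Literature.Analysis.FluidPDE.IsClassicalNSSolutionOn (Set.Ioo (-1) 0) 1 0 u p ∧ (∃ C : NNReal, ∀ t ∈ Set.Ioo (-1 : ℝ) 0, ∫⁻ x in Metric.ball (0 : EuclideanSpace ℝ (Fin 3)) 1, ‖u t x‖ₑ ^ 2 ≤ C) ∧ (∫⁻ t in Set.Ioo (-1 : ℝ) 0, ∫⁻ x in Metric.ball (0 : EuclideanSpace ℝ (Fin 3)) 1, ENNReal.ofReal (Literature.Analysis.FluidPDE.frobeniusNormSq (fderiv ℝ (u t) x)) < ⊤) ∧ (∀ y : EuclideanSpace ℝ (Fin 3), y ≠ 0 → Filter.Tendsto (fun t : ℝ => Real.sqrt (0 - t) • u t (Real.sqrt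 (0 - t) • y)) (nhdsWithin 0 (Set.Iio 0)) (nhds (V y))))
    (h₂ : ∃ ε : ℝ, 0 < ε ∧ ∀ (V : EuclideanSpace ℝ (Fin 3) → EuclideanSpace ℝ (Fin 3)) (Q : EuclideanSpace ℝ (Fin 3) → ℝ), ContDiffOn ℝ (⊤ : ℕ∞) V {0}ᶜ → ContDiffOn ℝ (⊤ : ℕ∞) Q {0}ᶜ → (∀ y : EuclideanSpace ℝ (Fin 3), y ≠ 0 → -((1 : ℝ) • Laplacian.laplacian V y) + (1 / 2 : ℝ) • V y + (1 / 2 : ℝ) • fderiv ℝ V y y + Literature.Analysis.FluidPDE.convect V V y + gradient Q y = 0) → (∀ y : EuclideanSpace ℝ (Fin 3), y ≠ 0 → Literature.Analysis.FluidPDE.VectorCalculus.divergence V y = 0) → (∀ y : EuclideanSpace ℝ (Fin 3), y ≠ 0 → ‖y‖ * ‖V y‖ ≤ ε) → ∀ c : ℝ, 0 < c → ∀ y : EuclideanSpace ℝ (Fin 3), y ≠ 0 → V (c • y) = c⁻¹ • V y) :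
    LandauTailLocal := by
  obtain ⟨ε, hε, hrig⟩ := h₂
  obtain ⟨u, p, V, Q, ⟨hV, hQ, hV0, heq, hdiv, hne, henv⟩, hcl, hE, hD, hconv⟩ := h₁ ε hε
  have hhom : ∀ c : ℝ, 0 < c → ∀ y : EuclideanSpace ℝ (Fin 3), y ≠ 0 → V (c • y) = c⁻¹ • V y :=
    hrig V Q hV hQ heq hdiv henv
  refine ⟨u, p, V, Q, ⟨hV, hQ, ?_, hdiv, ?_, hne⟩, hcl, hE, hD, hconv⟩
  · intro x hx
    have hdiff : DifferentiableAt ℝ V x :=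
      (hV.differentiableOn (by simp)).differentiableAt (isOpen_compl_singleton.mem_nhds hx)
    have hEul : fderiv ℝ V x x = (-1 : ℝ) • V x :=
      fderiv_apply_self_of_forall_inv_smul (fun c hc => hhom c hc x hx) hdiff
    have h0 := heq x hx
    rw [hEul, one_smul] at h0
    have key : (1 / 2 : ℝ) • V x + (1 / 2 : ℝ) • ((-1 : ℝ) • V x) = 0 := by
      rw [smul_smul, ← add_smul]; norm_num
    calc convect V V x + gradient Q x
        = (-(Laplacian.laplacian V x) + (1 / 2 : ℝ) • V x + (1 / 2 : ℝ) • ((-1 : ℝ) • V x) +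
            convect V V x + gradient Q x) + Laplacian.laplacian V x -
            ((1 / 2 : ℝ) • V x + (1 / 2 : ℝ) • ((-1 : ℝ) • V x)) := by abel
      _ = (1 : ℝ) • Laplacian.laplacian V x := by rw [h0, key]; simp
  · intro c hc x
    by_cases hx : x = 0
    · subst hx; simp [hV0]
    · exact hhom c hc x hx

/-- **Frozen-profile cut, outer glue**: `FrozenProfileLocal → PuncturedLerayRigiditySmall →
LandauTailTransfer → LandauTailBlowup` (the composition of line `frozen-rigidity`; conclusion = the crux
stmt-NavierStokesRegularity-1944 by name). [cite: MiuraTsai2012, Cor 1.5 (steady sibling)] -/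
theorem landauTailBlowup_of_frozenRigidity
    (h₁ : ∀ ε : ℝ, 0 < ε → ∃ (u : ℝ → EuclideanSpace ℝ (Fin 3) → EuclideanSpace ℝ (Fin 3)) (p : ℝ → EuclideanSpace ℝ (Fin 3) → ℝ) (V : EuclideanSpace ℝ (Fin 3) → EuclideanSpace ℝ (Fin 3)) (Q : EuclideanSpace ℝ (Fin 3) → ℝ), (ContDiffOn ℝ (⊤ : ℕ∞) V {0}ᶜ ∧ ContDiffOn ℝ (⊤ : ℕ∞) Q {0}ᶜ ∧ V 0 = 0 ∧ (∀ y : EuclideanSpace ℝ (Fin 3), y ≠ 0 → -((1 : ℝ) • Laplacian.laplacian V y) + (1 / 2 : ℝ) • V y + (1 / 2 : ℝ) • fderiv ℝ V y y + Literature.Analysis.FluidPDE.convect V V y + gradient Q y = 0) ∧ (∀ y : EuclideanSpace ℝ (Fin 3), y ≠ 0 → Literature.Analysis.FluidPDE.VectorCalculus.divergence V y = 0) ∧ (∃ y : EuclideanSpace ℝ (Fin 3), V y ≠ 0) ∧ (∀ y : EuclideanSpace ℝ (Fin 3), y ≠ 0 → ‖y‖ * ‖V y‖ ≤ ε)) ∧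 Literature.Analysis.FluidPDE.IsClassicalNSSolutionOn (Set.Ioo (-1) 0) 1 0 u p ∧ (∃ C : NNReal, ∀ t ∈ Set.Ioo (-1 : ℝ) 0, ∫⁻ x in Metric.ball (0 : EuclideanSpace ℝ (Fin 3)) 1, ‖u t x‖ₑ ^ 2 ≤ C) ∧ (∫⁻ t in Set.Ioo (-1 : ℝ) 0, ∫⁻ x in Metric.ball (0 : EuclideanSpace ℝ (Fin 3)) 1, ENNReal.ofReal (Literature.Analysis.FluidPDE.frobeniusNormSq (fderiv ℝ (u t) x)) < ⊤) ∧ (∀ y : EuclideanSpace ℝ (Fin 3), y ≠ 0 → Filter.Tendsto (fun t : ℝ => Real.sqrt (0 - t) • u t (Real.sqrt (0 - t) • y)) (nhdsWithin 0 (Set.Iio 0)) (nhds (V y))))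
    (h₂ : ∃ ε : ℝ, 0 < ε ∧ ∀ (V : EuclideanSpace ℝ (Fin 3) → EuclideanSpace ℝ (Fin 3)) (Q : EuclideanSpace ℝ (Fin 3) → ℝ), ContDiffOn ℝ (⊤ : ℕ∞) V {0}ᶜ → ContDiffOn ℝ (⊤ : ℕ∞) Q {0}ᶜ → (∀ y : EuclideanSpace ℝ (Fin 3), y ≠ 0 → -((1 : ℝ) • Laplacian.laplacian V y) + (1 / 2 : ℝ) • V y + (1 / 2 : ℝ) • fderiv ℝ V y y + Literature.Analysis.FluidPDE.convect V V y + gradient Q y = 0) → (∀ y : EuclideanSpace ℝ (Fin 3), y ≠ 0 → Literature.Analysis.FluidPDE.VectorCalculus.divergence V y = 0) → (∀ y : EuclideanSpace ℝ (Fin 3), y ≠ 0 → ‖y‖ * ‖V y‖ ≤ ε) → ∀ c : ℝ, 0 < c → ∀ y : EuclideanSpace ℝ (Fin 3), y ≠ 0 → V (c • y) = c⁻¹ • V y)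
    (h₃ : LandauTailTransfer) : LandauTailBlowup :=
  h₃ (landauTailLocal_of_frozenRigidity h₁ h₂)

end Summit.NavierStokesRegularity.NavierStokesRegularity.Cruxes.LandauTailBlowup.Split
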